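import Literature.Computability.AlgebraicComplexity.FSV18SuccinctGenerators
import HarnessLib

/-!
# Degree bound for depth-`D` occur-`k` formulas (FSV Def. 45 model; [ASSS16] §4 "char > s^D, i.e.
# the bound on the degree of `C`") — val-lit p1 g3, N1 occur push (plan step F2a)

Sources: FSV = arXiv:1701.05328 Def. 45 (= ToC Def. 5.21; tree `OccurFormula` with its `size` /
`depth`), [ASSS16] = arXiv:1111.0582 §4 ¶1 (p0009:L6: "assuming `char(𝔽) > s^D` (i.e. the bound on
the degree of `C`)"). Theorems only: the polynomial computed by an occur formula has total degree
`≤ (size + 1)^depth` (`OccurFormula.totalDegree_eval_le`), by structural induction over the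
tree's mutual inductive (leaf: FSV's size of a leaf `Σ_m (deg m + 1)` bounds its degree; `+` gates:
max; `×∧` gates: `Σ eᵢ · deg`); this feeds the characteristic clause of
`ASSS16.isHittingSetGenerator_succ_of_unitDifferences` / `ASSS16.exists_shift_sub_ne_zero` for
members of `occurClass`. Honest framing: bookkeeping; `VP ≠ VNP` is NOT proved.
-/

noncomputable section

namespace Literature.Computability.AlgebraicComplexity

open MvPolynomial Finset

variable {F : Type*} [Field F] {ι : Type*}

/-- A leaf's total degree is at most its FSV size `Σ_{m ∈ supp p} (deg m + 1)`. [cite: ForbesShpilkaVolk2018, Def. 45 (seq.) = ToC Def. 5.21 (size of a leaf)] -/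
theorem totalDegree_le_leafSize (p : MvPolynomial ι F) :
    p.totalDegree ≤ ∑ m ∈ p.support, (m.degree + 1) := by
  rw [totalDegree]
  refine Finset.sup_le fun m hm => ?_
  have h1 : (m.sum fun _ e => e) = m.degree := rfl
  rw [h1]
  exact (Nat.le_succ _).trans (Finset.single_le_sum (f := fun m : ι →₀ ℕ => m.degree + 1)
    (fun _ _ => Nat.zero_le _) hm)

/-- Monotonicity helper: `(a+1)^e ≤ (b+1)^{e'}` for `a ≤ b`, `e ≤ e'`. [folklore] -/
private theorem pow_succ_mono {a b e e' : ℕ} (hab : a ≤ b) (he : e ≤ e') :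
    (a + 1) ^ e ≤ (b + 1) ^ e' :=
  (Nat.pow_le_pow_left (Nat.succ_le_succ hab) e).trans (Nat.pow_le_pow_right (Nat.succ_pos b) he)

mutual
/-- **Degree of an occur formula** ([ASSS16] §4: "`s^D` … the bound on the degree of `C`"; here in
FSV's size/depth bookkeeping): `deg φ ≤ (size φ + 1)^{depth φ}`.
[cite: AgrawalEtAl2011, §4 (¶1); ForbesShpilkaVolk2018, Def. 45 (seq.) = ToC Def. 5.21]
locator: paper:arxiv-1111.0582 p0009.txt:L6 -/
theorem OccurFormula.totalDegree_eval_le : ∀ φ : OccurFormula F ι,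
    φ.eval.totalDegree ≤ (φ.size + 1) ^ φ.depth
  | .leaf p => by
    rw [OccurFormula.eval, OccurFormula.size, OccurFormula.depth]
    exact (totalDegree_le_leafSize p).trans
      ((Nat.le_succ _).trans (by
        have h := Nat.pow_le_pow_right (Nat.succ_pos (∑ m ∈ p.support, (m.degree + 1))) (show 1 ≤ 2 by omega)
        simpa using h))
  | .add as => by
    rw [OccurFormula.eval, OccurFormula.size, OccurFormula.depth]
    refine (OccurArgs.totalDegree_evalSum_le as).trans ?_
    exact pow_succ_mono (by omega) (by omega)
  | .powProd ps => by
    rw [OccurFormula.eval, OccurFormula.size, OccurFormula.depth]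
    refine (OccurPowArgs.totalDegree_evalProd_le ps).trans ?_
    calc OccurPowArgs.size ps * (OccurPowArgs.size ps + 1) ^ OccurPowArgs.depth ps
        ≤ (OccurPowArgs.size ps + 1) * (OccurPowArgs.size ps + 1) ^ OccurPowArgs.depth ps :=
          Nat.mul_le_mul_right _ (Nat.le_succ _)
      _ = (OccurPowArgs.size ps + 1) ^ (1 + OccurPowArgs.depth ps) := by ring

/-- The `+`-argument lists: `deg (Σ children) ≤ (size + 1)^{depth + 1}`. [cite: ForbesShpilkaVolk2018, Def. 45 (seq.) = ToC Def. 5.21] -/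
theorem OccurArgs.totalDegree_evalSum_le : ∀ as : OccurArgs F ι,
    as.evalSum.totalDegree ≤ (as.size + 1) ^ (as.depth + 1)
  | .nil => by
    rw [OccurArgs.evalSum, totalDegree_zero]
    exact Nat.zero_le _
  | .cons φ rest => by
    rw [OccurArgs.evalSum, OccurArgs.size, OccurArgs.depth]
    refine (totalDegree_add _ _).trans (max_le ?_ ?_)
    · exact (OccurFormula.totalDegree_eval_le φ).trans (pow_succ_mono (by omega) (by omega))
    · exact (OccurArgs.totalDegree_evalSum_le rest).trans (pow_succ_mono (by omega) (by omega))

/-- The `×∧`-argument lists: `deg (∏ childᵢ^{eᵢ}) ≤ size · (size + 1)^{depth}`. [cite: ForbesShpilkaVolk2018, Def. 45 (seq.) = ToC Def. 5.21] -/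
theorem OccurPowArgs.totalDegree_evalProd_le : ∀ ps : OccurPowArgs F ι,
    ps.evalProd.totalDegree ≤ ps.size * (ps.size + 1) ^ ps.depth
  | .nil => by
    rw [OccurPowArgs.evalProd, totalDegree_one]
    exact Nat.zero_le _
  | .cons φ e rest => by
    rw [OccurPowArgs.evalProd, OccurPowArgs.size, OccurPowArgs.depth]
    refine (totalDegree_mul _ _).trans ?_
    have h1 : (φ.eval ^ e).totalDegree ≤ e * (e + φ.size + rest.size + 1) ^ max φ.depth rest.depth :=
      (totalDegree_pow _ _).trans (Nat.mul_le_mul_left _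
        ((OccurFormula.totalDegree_eval_le φ).trans (pow_succ_mono (by omega) (le_max_left _ _))))
    have h2 : rest.evalProd.totalDegree ≤ rest.size * (e + φ.size + rest.size + 1) ^ max φ.depth rest.depth :=
      (OccurPowArgs.totalDegree_evalProd_le rest).trans (Nat.mul_le_mul_left _
        (pow_succ_mono (by omega) (le_max_right _ _)))
    calc (φ.eval ^ e).totalDegree + rest.evalProd.totalDegree
        ≤ e * (e + φ.size + rest.size + 1) ^ max φ.depth rest.depth +
            rest.size * (e + φ.size + rest.size + 1) ^ max φ.depth rest.depth := Nat.add_le_add h1 h2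
      _ = (e + rest.size) * (e + φ.size + rest.size + 1) ^ max φ.depth rest.depth := by ring
      _ ≤ (e + φ.size + rest.size) * (e + φ.size + rest.size + 1) ^ max φ.depth rest.depth :=
          Nat.mul_le_mul_right _ (by omega)
end

/-- **Members of `occurClass D k s` have total degree `≤ (s+1)^D`** — the degree bound that
[ASSS16] §4 phrases as "`char(𝔽) > s^D` (i.e. the bound on the degree of `C`)", in FSV's size
convention. [cite: AgrawalEtAl2011, §4 (¶1); ForbesShpilkaVolk2018, Def. 45 and Cor. 49 (seq.) = ToC Def. 5.21, Cor. 5.25] -/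
theorem totalDegree_le_of_mem_occurClass {D k s : ℕ} {f : MvPolynomial ι F}
    (hf : f ∈ occurClass F ι D k s) : f.totalDegree ≤ (s + 1) ^ D := by
  obtain ⟨φ, hφ, hD, -, hs⟩ := hf
  rw [← hφ]
  exact (OccurFormula.totalDegree_eval_le φ).trans (pow_succ_mono hs hD)

end Literature.Computability.AlgebraicComplexity

end
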